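import Literature.NumberTheory.EllipticCurves.LatticeHomOfCurve
import Mathlib.Algebra.Module.ZLattice.Covolume
import Mathlib.MeasureTheory.Measure.Lebesgue.Complex
import HarnessLib

/-!
# The kernel of an isogeny `E_{Λ₁} → E_{Λ₂}` given by rational functions: `#ker = [Λ₂ : αΛ₁]`

Topic `NumberTheory/EllipticCurves`; a proofs-only sequel (theorems only: no definitions, no
named facts) of `LatticeHomOfCurve.lean`, in `namespace PeriodPair` (deliberate dot-notation
extensions of Mathlib's `PeriodPair`, as there).

`LatticeHomOfCurve.exists_mul_of_curve_hom` proves Silverman, *AEC*, Thm. VI.4.1(b) in the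
local form used by the tree: a homomorphism `φ : M₁ → M₂` between abstract groups embedded in
`E_{Λ₁}(ℂ)`, `E_{Λ₂}(ℂ)` (`fᵢ : Mᵢ ↪ E_{Λᵢ}(ℂ)`, the image of `M₁` containing the torsion) with
finite kernel and given off a finite set by a rational map is, through the parametrisations
`πᵢ : z ↦ (℘_{Λᵢ}(z), ℘_{Λᵢ}'(z)/2)`, multiplication by some `α ≠ 0` with `αΛ₁ ⊆ Λ₂` — but it
only *exports* `αΛ₁ ⊆ Λ₂` and the coordinate identity `α · 2p₂q₁² = (δp₁·q₁ − p₁·δq₁)·q₂` for the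
multiplier. This file re-runs that proof verbatim to export the **analytic representation
itself**, `f₂ (φ m) = π₂ (αz)` whenever `f₁ m = π₁ z` (`exists_mul_of_curve_hom_apply`), and
derives the **kernel** of `φ` (Silverman, *AEC*, Thm. VI.4.1 with Prop. III.4.12 / Cor. III.6.4
flavour: `ker(z ↦ αz : ℂ/Λ₁ → ℂ/Λ₂) = α⁻¹Λ₂/Λ₁`):

* `apply_eq_zero_iff_mul_mem_lattice`: `φ m = 0 ↔ αz ∈ Λ₂` for `f₁ m = π₁ z`;
* `relIndex_mulLeft_ne_zero`, `relIndex_mulLeft_eq_relIndex_comap`: `[Λ₂ : αΛ₁]` is finite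
  (covolumes, Mathlib `ZLattice.covolume_div_covolume_eq_relIndex'`) and equals `[α⁻¹Λ₂ : Λ₁]`;
* `card_ker_eq_relIndex_of_apply_eq`: **`#ker φ = [Λ₂ : αΛ₁]`** — the map `α⁻¹Λ₂ → ker φ`,
  `z ↦ f₁⁻¹(π₁ z)` (defined because `π₁ z` is `[Λ₂ : αΛ₁]`-torsion, hence in the image of
  `M₁`) is a surjective homomorphism with kernel `Λ₁`;
* `exists_mul_of_curve_hom_card_ker`: the packaged statement `∃ α ≠ 0`, `αΛ₁ ⊆ Λ₂`,
  `[Λ₂ : αΛ₁] = #ker φ`, together with the representation and the coordinate identity.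

This is the "`deg φ_α = [Λ₂ : αΛ₁]`" needed to turn `αΛ₁ ⊆ Λ₂` into the covolume identity
`|α|² covol(Λ₁) = deg φ · covol(Λ₂)` (Faltings' `‖φ^*α‖² = deg φ ‖α‖²`) for isogenies of
elliptic curves over number fields read at a complex embedding. Everything is proved; no
statement of the tree is changed.

## References

* J. H. Silverman, *The Arithmetic of Elliptic Curves*, 2nd ed., GTM 106, Springer 2009:
  Thm. VI.4.1 (PDF pp. 152–154), Prop. VI.3.6(b), III.4 (kernel and degree of a separable
  isogeny, Thm. III.4.10(c)). [SilvermanAEC2009]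
-/

noncomputable section

open Complex Filter Topology Set

namespace PeriodPair

open Literature.NumberTheory.EllipticCurves

/-! ### The analytic representation, exported -/

/-- **Silverman, *AEC*, Thm. VI.4.1(b), local form, with the analytic representation exported.**
Same hypotheses and proof as the tree's `PeriodPair.exists_mul_of_curve_hom` (abstract groups
`fᵢ : Mᵢ ↪ E_{Λᵢ}(ℂ)`, the image of `M₁` containing all torsion; `φ : M₁ →+ M₂` with finite
kernel, agreeing off a finite set with the rational map `(p₁/q₁, p₂/q₂)`); the conclusion adds
to `α ≠ 0`, `αΛ₁ ⊆ Λ₂` and the coordinate identity for the multiplier the statement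
**`f₂ (φ m) = π₂ (α z)` whenever `f₁ m = π₁ z`** (`πᵢ = PeriodPair.toPoint`), i.e.
"`φ(z) = αz (mod Λ₂)`" of *AEC* VI.4.1(b). The proof is that of `exists_mul_of_curve_hom`
(local holomorphic lifts are affine, additivity spreads `Ψ ≡ α·` to the whole group,
`exists_mul_of_rational_lift₂`), which establishes this congruence on the way.
[cite: SilvermanAEC2009, Thm. VI.4.1(b) (PDF pp. 152–154)] -/
theorem exists_mul_of_curve_hom_apply (L₁ L₂ : PeriodPair) {M₁ M₂ : Type*} [AddCommGroup M₁]
    [AddCommGroup M₂] [Infinite M₁] (φ : M₁ →+ M₂) (hker : (φ.ker : Set M₁).Finite)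
    (f₁ : M₁ →+ L₁.curve.toAffine.Point) (hf₁ : Function.Injective f₁)
    (f₂ : M₂ →+ L₂.curve.toAffine.Point) (hf₂ : Function.Injective f₂)
    (htors : ∀ n : ℕ, 0 < n → ∀ P : L₁.curve.toAffine.Point, n • P = 0 → P ∈ f₁.range)
    (p₁ q₁ p₂ q₂ : MvPolynomial (Fin 2) ℂ)
    (halg : {m : M₁ | ¬ ∃ (x y : ℂ) (h : L₁.curve.toAffine.Nonsingular x y),
        f₁ m = .some x y h ∧ MvPolynomial.eval ![x, y] q₁ ≠ 0 ∧ MvPolynomial.eval ![x, y] q₂ ≠ 0 ∧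
        ∃ h' : L₂.curve.toAffine.Nonsingular
            (MvPolynomial.eval ![x, y] p₁ / MvPolynomial.eval ![x, y] q₁)
            (MvPolynomial.eval ![x, y] p₂ / MvPolynomial.eval ![x, y] q₂),
          f₂ (φ m) = .some _ _ h'}.Finite) :
    ∃ α : ℂ, α ≠ 0 ∧ (∀ l ∈ L₁.lattice, α * l ∈ L₂.lattice) ∧
      (∀ (m : M₁) (z : ℂ), f₁ m = L₁.toPoint z → f₂ (φ m) = L₂.toPoint (α * z)) ∧
      ∀ (p₁' q₁' p₂' q₂' : MvPolynomial (Fin 2) ℂ),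
        {m : M₁ | ¬ ∃ (x y : ℂ) (h : L₁.curve.toAffine.Nonsingular x y),
          f₁ m = .some x y h ∧ MvPolynomial.eval ![x, y] q₁' ≠ 0 ∧
          MvPolynomial.eval ![x, y] q₂' ≠ 0 ∧
          ∃ h' : L₂.curve.toAffine.Nonsingular
              (MvPolynomial.eval ![x, y] p₁' / MvPolynomial.eval ![x, y] q₁')
              (MvPolynomial.eval ![x, y] p₂' / MvPolynomial.eval ![x, y] q₂'),
            f₂ (φ m) = .some _ _ h'}.Finite →
        ∀ (m : M₁) (x y : ℂ) (h : L₁.curve.toAffine.Nonsingular x y), f₁ m = .some x y h →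
          α * MvPolynomial.eval ![x, y] (MvPolynomial.C 2 * p₂' * q₁' ^ 2) =
            MvPolynomial.eval ![x, y]
              ((L₁.curve.invariantDerivation p₁' * q₁' - p₁' * L₁.curve.invariantDerivation q₁') * q₂') := by
  classical
  set π₁ : ℂ →+ L₁.curve.toAffine.Point := toPointHom (toPoint_add_holds (L := L₁)) with hπ₁
  have hπ₁app : ∀ z, π₁ z = L₁.toPoint z := fun z ↦ rfl
  -- the group `G = π₁⁻¹(f₁(M₁))` and the section `μ : G → M₁`
  set G : AddSubgroup ℂ := f₁.range.comap π₁ with hG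
  have hmemG : ∀ z, z ∈ G ↔ ∃ m, f₁ m = L₁.toPoint z := fun z ↦ by
    simp only [hG, AddSubgroup.mem_comap, AddMonoidHom.mem_range, hπ₁app]
  set μ : ℂ → M₁ := fun z ↦ if h : ∃ m, f₁ m = L₁.toPoint z then h.choose else 0 with hμ
  have hμspec : ∀ z ∈ G, f₁ (μ z) = L₁.toPoint z := by
    intro z hz
    have h := (hmemG z).1 hz
    simp only [hμ, dif_pos h]
    exact h.choose_spec
  have hμadd : ∀ z ∈ G, ∀ w ∈ G, μ (z + w) = μ z + μ w := by
    intro z hz w hw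
    apply hf₁
    rw [map_add, hμspec z hz, hμspec w hw, hμspec (z + w) (G.add_mem hz hw)]
    exact toPoint_add_holds (L := L₁) z w
  have hμeq : ∀ m z, f₁ m = L₁.toPoint z → z ∈ G ∧ μ z = m := fun m z hz ↦ by
    have hzG : z ∈ G := (hmemG z).2 ⟨m, hz⟩
    exact ⟨hzG, hf₁ (by rw [hμspec z hzG, hz])⟩
  -- the lift `Ψ` of `f₂ ∘ φ ∘ μ` through `π₂`
  set Ψ : ℂ → ℂ := fun z ↦ (L₂.toPoint_surjective (f₂ (φ (μ z)))).choose with hΨ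
  have hΨspec : ∀ z, L₂.toPoint (Ψ z) = f₂ (φ (μ z)) := fun z ↦
    (L₂.toPoint_surjective (f₂ (φ (μ z)))).choose_spec
  have hadd : ∀ z ∈ G, ∀ w ∈ G, Ψ (z + w) - Ψ z - Ψ w ∈ L₂.lattice := by
    intro z hz w hw
    have h : L₂.toPoint (Ψ (z + w)) = L₂.toPoint (Ψ z + Ψ w) := by
      rw [toPoint_add_holds (L := L₂), hΨspec, hΨspec, hΨspec, hμadd z hz w hw, map_add,
        map_add]
    have := L₂.toPoint_eq_toPoint_iff.1 h
    rwa [show Ψ (z + w) - (Ψ z + Ψ w) = Ψ (z + w) - Ψ z - Ψ w by ring] at this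
  -- division points of `Λ₁` lie in `G`
  have hdiv : ∀ n : ℕ, 0 < n → ∀ l ∈ L₁.lattice, l / n ∈ G := by
    intro n hn l hl
    rw [hG, AddSubgroup.mem_comap]
    refine htors n hn _ ?_
    rw [← map_nsmul, hπ₁app, nsmul_eq_mul, mul_div_cancel₀ _ (by exact_mod_cast hn.ne')]
    exact toPoint_of_mem hl
  -- every rational representation of `φ` yields a rational description of `Ψ` off finitely
  -- many cosets of `Λ₁`
  have hrep : ∀ (p₁' q₁' p₂' q₂' : MvPolynomial (Fin 2) ℂ),
      {m : M₁ | ¬ ∃ (x y : ℂ) (h : L₁.curve.toAffine.Nonsingular x y),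
        f₁ m = .some x y h ∧ MvPolynomial.eval ![x, y] q₁' ≠ 0 ∧
        MvPolynomial.eval ![x, y] q₂' ≠ 0 ∧
        ∃ h' : L₂.curve.toAffine.Nonsingular
            (MvPolynomial.eval ![x, y] p₁' / MvPolynomial.eval ![x, y] q₁')
            (MvPolynomial.eval ![x, y] p₂' / MvPolynomial.eval ![x, y] q₂'),
          f₂ (φ m) = .some _ _ h'}.Finite →
      ∃ T : Finset ℂ, ∀ z ∈ G, (∀ t ∈ T, z - t ∉ L₁.lattice) →
        z ∉ L₁.lattice ∧ Ψ z ∉ L₂.lattice ∧ ℘'[L₂] (Ψ z) ≠ 0 ∧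
        MvPolynomial.eval ![℘[L₁] z, ℘'[L₁] z / 2] q₁' ≠ 0 ∧
        MvPolynomial.eval ![℘[L₁] z, ℘'[L₁] z / 2] q₂' ≠ 0 ∧
        ℘[L₂] (Ψ z) = MvPolynomial.eval ![℘[L₁] z, ℘'[L₁] z / 2] p₁' /
          MvPolynomial.eval ![℘[L₁] z, ℘'[L₁] z / 2] q₁' ∧
        ℘'[L₂] (Ψ z) / 2 = MvPolynomial.eval ![℘[L₁] z, ℘'[L₁] z / 2] p₂' /
          MvPolynomial.eval ![℘[L₁] z, ℘'[L₁] z / 2] q₂' := by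
    intro p₁' q₁' p₂' q₂' hSfin
    set S : Set M₁ := {m : M₁ | ¬ ∃ (x y : ℂ) (h : L₁.curve.toAffine.Nonsingular x y),
        f₁ m = .some x y h ∧ MvPolynomial.eval ![x, y] q₁' ≠ 0 ∧
        MvPolynomial.eval ![x, y] q₂' ≠ 0 ∧
        ∃ h' : L₂.curve.toAffine.Nonsingular
            (MvPolynomial.eval ![x, y] p₁' / MvPolynomial.eval ![x, y] q₁')
            (MvPolynomial.eval ![x, y] p₂' / MvPolynomial.eval ![x, y] q₂'),
          f₂ (φ m) = .some _ _ h'} with hS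
    -- the exceptional set: non-agreeing points, and points mapped to `E_{Λ₂}[2]`
    set E2 : Set L₂.curve.toAffine.Point :=
      (AddSubgroup.torsionBy L₂.curve.toAffine.Point ((2 : ℕ) : ℤ) : Set L₂.curve.toAffine.Point)
      with hE2
    have hE2fin : E2.Finite := by
      have hcard := WeierstrassCurve.card_torsionBy_eq_sq (E := L₂.curve) (n := 2) (by norm_num)
      have : Finite (AddSubgroup.torsionBy L₂.curve.toAffine.Point ((2 : ℕ) : ℤ)) :=
        Nat.finite_of_card_ne_zero (by rw [hcard]; norm_num)
      exact Set.toFinite _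
    set S₂ : Set M₁ := S ∪ φ ⁻¹' (f₂ ⁻¹' E2) with hS₂
    have hS₂fin : S₂.Finite :=
      hSfin.union (finite_preimage_of_finite_ker φ hker (hE2fin.preimage hf₂.injOn))
    -- lifts of the exceptional points to `ℂ`, and the finite set `T` of bad cosets
    set lift : L₁.curve.toAffine.Point → ℂ := fun P ↦ (L₁.toPoint_surjective P).choose with hlift
    have hliftspec : ∀ P, L₁.toPoint (lift P) = P := fun P ↦ (L₁.toPoint_surjective P).choose_spec
    set Tset : Set ℂ := (fun m ↦ lift (f₁ m)) '' S₂ ∪ {0} with hTset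
    have hTfin : Tset.Finite := (hS₂fin.image _).union (Set.finite_singleton 0)
    refine ⟨hTfin.toFinset, fun z hzG hzT ↦ ?_⟩
    have hmemT : ∀ t, t ∈ hTfin.toFinset ↔ t ∈ Tset := fun t ↦ hTfin.mem_toFinset
    have hz0 : z ∉ L₁.lattice := by
      have := hzT 0 ((hmemT 0).2 (Or.inr rfl))
      rwa [sub_zero] at this
    set m₀ := μ z with hm₀
    have hm₀spec : f₁ m₀ = L₁.toPoint z := hμspec z hzG
    have hm₀S₂ : m₀ ∉ S₂ := by
      intro hmem
      have ht : lift (f₁ m₀) ∈ hTfin.toFinset := (hmemT _).2 (Or.inl ⟨m₀, hmem, rfl⟩)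
      apply hzT _ ht
      apply L₁.toPoint_eq_toPoint_iff.1
      rw [hliftspec, hm₀spec]
    have hm₀S : m₀ ∉ S := fun h ↦ hm₀S₂ (Or.inl h)
    have hm₀E2 : f₂ (φ m₀) ∉ E2 := fun h ↦ hm₀S₂ (Or.inr h)
    simp only [hS, mem_setOf_eq, not_not] at hm₀S
    obtain ⟨x, y, hxy, hfm, hq₁, hq₂, h', hfφ⟩ := hm₀S
    rw [hm₀spec, toPoint_of_notMem hz0] at hfm
    obtain ⟨rfl, rfl⟩ : x = ℘[L₁] z ∧ y = ℘'[L₁] z / 2 :=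
      WeierstrassCurve.Affine.Point.some.inj hfm.symm
    have hΨz' : L₂.toPoint (Ψ z) = f₂ (φ m₀) := by rw [hm₀]; exact hΨspec z
    have hΨz := hΨz'
    rw [hfφ] at hΨz
    have hΨ0 : Ψ z ∉ L₂.lattice := by
      intro hmem
      rw [toPoint_of_mem hmem] at hΨz
      exact (WeierstrassCurve.Affine.Point.some_ne_zero h') hΨz.symm
    rw [toPoint_of_notMem hΨ0] at hΨz
    obtain ⟨h℘, h℘'⟩ := WeierstrassCurve.Affine.Point.some.inj hΨz
    refine ⟨hz0, hΨ0, fun h0 ↦ hm₀E2 ?_, hq₁, hq₂, h℘, h℘'⟩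
    -- `℘₂'(Ψ z) = 0` would make `f₂ (φ m₀) = π₂ (Ψ z)` a `2`-torsion point
    have hP : L₂.toPoint (Ψ z) = -L₂.toPoint (Ψ z) := by
      rw [toPoint_of_notMem hΨ0, WeierstrassCurve.Affine.Point.neg_some]
      simp only [WeierstrassCurve.Affine.negY, WeierstrassCurve.toAffine, curve_a₁, curve_a₃]
      congr 1
      rw [h0]; ring
    rw [hE2, SetLike.mem_coe, AddSubgroup.torsionBy.nsmul_iff, ← hΨz', two_nsmul,
      add_eq_zero_iff_eq_neg]
    exact hP
  -- the multiplier `α`, from the given representation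
  obtain ⟨T, hT⟩ := hrep p₁ q₁ p₂ q₂ halg
  obtain ⟨α, hαΛ, hlin⟩ := exists_mul_of_rational_lift₂ L₁ L₂ G hdiv Ψ hadd p₁ q₁ p₂ q₂ T hT
  -- `α ≠ 0`: otherwise `φ = 0` would have infinite kernel
  have hα : α ≠ 0 := by
    intro hα0
    have hφ0 : ∀ m, φ m = 0 := by
      intro m
      obtain ⟨z, hz⟩ := L₁.toPoint_surjective (f₁ m)
      obtain ⟨hzG, hμz⟩ := hμeq m z hz.symm
      have h1 := hlin z hzG
      rw [hα0, zero_mul, sub_zero] at h1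
      have h2 : L₂.toPoint (Ψ z) = 0 := toPoint_of_mem h1
      rw [hΨspec, hμz] at h2
      exact hf₂ (by rw [h2, map_zero])
    have huniv : (φ.ker : Set M₁) = Set.univ := by
      ext m
      simp [hφ0 m]
    rw [huniv] at hker
    exact Set.infinite_univ hker
  refine ⟨α, hα, hαΛ, fun m z hz ↦ ?_, fun p₁' q₁' p₂' q₂' halg' m x y h hm ↦ ?_⟩
  · -- the analytic representation: `f₂ (φ m) = π₂ (α z)` whenever `f₁ m = π₁ z`
    obtain ⟨hzG, hμz⟩ := hμeq m z hz
    rw [← hμz, ← hΨspec z]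
    exact L₂.toPoint_eq_toPoint_iff.2 (hlin z hzG)
  obtain ⟨T', hT'⟩ := hrep p₁' q₁' p₂' q₂' halg'
  obtain ⟨z, hz⟩ := L₁.toPoint_surjective (f₁ m)
  have hz0 : z ∉ L₁.lattice := by
    intro hmem
    rw [toPoint_of_mem hmem, hm] at hz
    exact WeierstrassCurve.Affine.Point.some_ne_zero h hz.symm
  rw [toPoint_of_notMem hz0, hm] at hz
  obtain ⟨rfl, rfl⟩ : x = ℘[L₁] z ∧ y = ℘'[L₁] z / 2 :=
    WeierstrassCurve.Affine.Point.some.inj hz.symm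
  exact mul_eval_eq_of_rational_of_linear L₁ L₂ G hdiv Ψ hlin p₁' q₁' p₂' q₂' T' hT' hz0

/-! ### The kernel of `φ`: `#ker φ = [Λ₂ : αΛ₁]` -/

variable {L₁ L₂ : PeriodPair}

/-- If `φ` is `z ↦ αz` through the parametrisations (`f₂ (φ m) = π₂ (αz)` whenever
`f₁ m = π₁ z`) and `f₂` is injective, then `φ m = 0 ↔ αz ∈ Λ₂`: the kernel of
`z ↦ αz : ℂ/Λ₁ → ℂ/Λ₂` is `α⁻¹Λ₂/Λ₁` (Silverman, *AEC*, Thm. VI.4.1; cf. Prop. VI.3.6(b) for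
`π⁻¹(O) = Λ`). [cite: SilvermanAEC2009, Thm. VI.4.1 (PDF pp. 152–154)] -/
theorem apply_eq_zero_iff_mul_mem_lattice {M₁ M₂ : Type*} [AddCommGroup M₁] [AddCommGroup M₂]
    {φ : M₁ →+ M₂} {f₁ : M₁ →+ L₁.curve.toAffine.Point} {f₂ : M₂ →+ L₂.curve.toAffine.Point}
    (hf₂ : Function.Injective f₂) {α : ℂ}
    (hrep : ∀ (m : M₁) (z : ℂ), f₁ m = L₁.toPoint z → f₂ (φ m) = L₂.toPoint (α * z))
    {m : M₁} {z : ℂ} (hm : f₁ m = L₁.toPoint z) : φ m = 0 ↔ α * z ∈ L₂.lattice := by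
  rw [← toPoint_eq_zero_iff, ← hrep m z hm]
  constructor
  · intro h
    rw [h, map_zero]
  · intro h
    exact hf₂ (h.trans (map_zero f₂).symm)

/-- `[Λ₂ : αΛ₁]` is finite (non-zero) as soon as `αΛ₁ ⊆ Λ₂`, `α ≠ 0`: both are lattices in
`ℂ` and `covol(αΛ₁)/covol(Λ₂) = [Λ₂ : αΛ₁]` (Mathlib `ZLattice.covolume_div_covolume_eq_relIndex'`)
is a quotient of positive reals. [folklore] -/
theorem relIndex_mulLeft_ne_zero {α : ℂ} (hα : α ≠ 0)
    (hle : (L₁.mulLeft α hα).lattice ≤ L₂.lattice) :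
    (L₁.mulLeft α hα).lattice.toAddSubgroup.relIndex L₂.lattice.toAddSubgroup ≠ 0 := by
  intro h0
  have h := ZLattice.covolume_div_covolume_eq_relIndex' (L₁.mulLeft α hα).lattice L₂.lattice hle
  rw [h0, Nat.cast_zero, div_eq_zero_iff] at h
  rcases h with h | h
  · exact (ZLattice.covolume_pos _ _).ne' h
  · exact (ZLattice.covolume_pos _ _).ne' h

/-- `αΛ₁ ⊆ Λ₂` in the form `mulLeft`: if `αl ∈ Λ₂` for all `l ∈ Λ₁` then
`(L₁.mulLeft α).lattice ≤ L₂.lattice`. [folklore] -/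
theorem mulLeft_lattice_le_of_forall_mul_mem {α : ℂ} (hα : α ≠ 0)
    (hαΛ : ∀ l ∈ L₁.lattice, α * l ∈ L₂.lattice) : (L₁.mulLeft α hα).lattice ≤ L₂.lattice := by
  intro x hx
  have h := hαΛ _ (mem_mulLeft_lattice.mp hx)
  rwa [← mul_assoc, mul_inv_cancel₀ hα, one_mul] at h

/-- The image of `Λ₁` under `z ↦ αz` is `αΛ₁ = (L₁.mulLeft α).lattice` (as additive subgroups of
`ℂ`). [folklore] -/
theorem map_mulLeft_lattice_toAddSubgroup {α : ℂ} (hα : α ≠ 0) :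
    L₁.lattice.toAddSubgroup.map (AddMonoidHom.mulLeft α) =
      (L₁.mulLeft α hα).lattice.toAddSubgroup := by
  ext x
  simp only [AddSubgroup.mem_map, Submodule.mem_toAddSubgroup, AddMonoidHom.coe_mulLeft]
  constructor
  · rintro ⟨l, hl, rfl⟩
    exact mul_mem_mulLeft_lattice.mpr hl
  · intro hx
    exact ⟨α⁻¹ * x, mem_mulLeft_lattice.mp hx, by rw [← mul_assoc, mul_inv_cancel₀ hα, one_mul]⟩

/-- **`[Λ₂ : αΛ₁] = [α⁻¹Λ₂ : Λ₁]`**: multiplication by `α ≠ 0` is an automorphism of `(ℂ, +)`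
carrying `Λ₁ ⊆ α⁻¹Λ₂` onto `αΛ₁ ⊆ Λ₂` (Mathlib `AddSubgroup.relIndex_map_map_of_injective`).
[folklore] -/
theorem relIndex_mulLeft_eq_relIndex_comap {α : ℂ} (hα : α ≠ 0) :
    (L₁.mulLeft α hα).lattice.toAddSubgroup.relIndex L₂.lattice.toAddSubgroup =
      L₁.lattice.toAddSubgroup.relIndex
        (L₂.lattice.toAddSubgroup.comap (AddMonoidHom.mulLeft α)) := by
  have hinj : Function.Injective (AddMonoidHom.mulLeft α : ℂ →+ ℂ) := mul_right_injective₀ hα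
  have hsurj : Function.Surjective (AddMonoidHom.mulLeft α : ℂ →+ ℂ) := fun z ↦
    ⟨α⁻¹ * z, by rw [AddMonoidHom.coe_mulLeft, ← mul_assoc, mul_inv_cancel₀ hα, one_mul]⟩
  rw [← AddSubgroup.relIndex_map_map_of_injective L₁.lattice.toAddSubgroup
      (L₂.lattice.toAddSubgroup.comap (AddMonoidHom.mulLeft α)) hinj,
    map_mulLeft_lattice_toAddSubgroup hα, AddSubgroup.map_comap_eq_self_of_surjective hsurj]

/-- **The kernel of an isogeny `z ↦ αz` has `[Λ₂ : αΛ₁]` elements.** In the setting of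
`exists_mul_of_curve_hom_apply` (abstract groups `fᵢ : Mᵢ ↪ E_{Λᵢ}(ℂ)`, all torsion of
`E_{Λ₁}(ℂ)` in the image of `M₁`), if `φ : M₁ →+ M₂` is `z ↦ αz` through the parametrisations
with `α ≠ 0`, `αΛ₁ ⊆ Λ₂`, then `#ker φ = [Λ₂ : αΛ₁]`. Proof: `[Λ₂ : αΛ₁] = [A : Λ₁]` for
`A = α⁻¹Λ₂` (`relIndex_mulLeft_eq_relIndex_comap`); the restriction of `π₁` to `A` has kernel
`Λ₁` and image `f₁(ker φ)` — every `z ∈ A` has `nz ∈ Λ₁` for some `0 < n ≤ [Λ₂ : αΛ₁]`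
(Mathlib `AddSubgroup.exists_nsmul_mem_of_relIndex_ne_zero`), so `π₁ z` is torsion, hence
`π₁ z = f₁ m`, and `f₂ (φ m) = π₂(αz) = O`; conversely `φ m = 0`, `f₁ m = π₁ z` give `αz ∈ Λ₂`
— so `[A : Λ₁] = #f₁(ker φ) = #ker φ` (`AddSubgroup.index_ker`). This is
`deg(z ↦ αz) = #(α⁻¹Λ₂/Λ₁) = [Λ₂ : αΛ₁]` (Silverman, *AEC*, Thm. VI.4.1 and III.4.10(c): the
kernel of a separable isogeny has `deg` elements). [cite: SilvermanAEC2009, Thm. VI.4.1 (PDF pp. 152–154)] -/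
theorem card_ker_eq_relIndex_of_apply_eq {M₁ M₂ : Type*} [AddCommGroup M₁] [AddCommGroup M₂]
    (φ : M₁ →+ M₂) (f₁ : M₁ →+ L₁.curve.toAffine.Point) (hf₁ : Function.Injective f₁)
    (f₂ : M₂ →+ L₂.curve.toAffine.Point) (hf₂ : Function.Injective f₂)
    (htors : ∀ n : ℕ, 0 < n → ∀ P : L₁.curve.toAffine.Point, n • P = 0 → P ∈ f₁.range)
    {α : ℂ} (hα : α ≠ 0) (hαΛ : ∀ l ∈ L₁.lattice, α * l ∈ L₂.lattice)
    (hrep : ∀ (m : M₁) (z : ℂ), f₁ m = L₁.toPoint z → f₂ (φ m) = L₂.toPoint (α * z)) :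
    Nat.card φ.ker =
      (L₁.mulLeft α hα).lattice.toAddSubgroup.relIndex L₂.lattice.toAddSubgroup := by
  classical
  set π₁ : ℂ →+ L₁.curve.toAffine.Point := toPointHom (toPoint_add_holds (L := L₁)) with hπ₁
  have hπ₁app : ∀ z, π₁ z = L₁.toPoint z := fun z ↦ rfl
  -- `A = α⁻¹Λ₂`
  set A : AddSubgroup ℂ := L₂.lattice.toAddSubgroup.comap (AddMonoidHom.mulLeft α) with hA
  have hmemA : ∀ z, z ∈ A ↔ α * z ∈ L₂.lattice := fun z ↦ Iff.rfl
  have hle : (L₁.mulLeft α hα).lattice ≤ L₂.lattice := mulLeft_lattice_le_of_forall_mul_mem hα hαΛ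
  set N := (L₁.mulLeft α hα).lattice.toAddSubgroup.relIndex L₂.lattice.toAddSubgroup with hN
  have hN0 : N ≠ 0 := relIndex_mulLeft_ne_zero hα hle
  rw [hN, relIndex_mulLeft_eq_relIndex_comap hα]
  -- the restriction `g` of `π₁` to `A`; its kernel is `Λ₁`
  set g : A →+ L₁.curve.toAffine.Point := π₁.comp A.subtype with hg
  have hgker : g.ker = L₁.lattice.toAddSubgroup.addSubgroupOf A := by
    ext z
    simp only [hg, AddMonoidHom.mem_ker, AddMonoidHom.coe_comp, Function.comp_apply,
      AddSubgroup.coe_subtype, hπ₁app, toPoint_eq_zero_iff, AddSubgroup.mem_addSubgroupOf,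
      Submodule.mem_toAddSubgroup]
  -- its image is `f₁(ker φ)`
  have hgrange : g.range = φ.ker.map f₁ := by
    ext P
    simp only [AddMonoidHom.mem_range, AddSubgroup.mem_map, AddMonoidHom.mem_ker]
    constructor
    · rintro ⟨⟨z, hz⟩, rfl⟩
      -- `π₁ z` is torsion: `n • z ∈ Λ₁` with `0 < n ≤ N`
      obtain ⟨n, hn, -, hnz⟩ := AddSubgroup.exists_nsmul_mem_of_relIndex_ne_zero hN0
        (a := α * z) ((hmemA z).1 hz)
      have hnz' : (n : ℂ) * z ∈ L₁.lattice := by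
        have h1 : n • (α * z) ∈ (L₁.mulLeft α hα).lattice := (AddSubgroup.mem_inf.1 hnz).1
        rw [nsmul_eq_mul, ← mul_assoc, mul_comm (n : ℂ) α, mul_assoc] at h1
        exact mul_mem_mulLeft_lattice.mp h1
      have htor : n • π₁ z = 0 := by
        rw [← map_nsmul, hπ₁app, nsmul_eq_mul]
        exact toPoint_of_mem hnz'
      obtain ⟨m, hm⟩ := htors n hn _ htor
      refine ⟨m, ?_, hm⟩
      exact (apply_eq_zero_iff_mul_mem_lattice hf₂ hrep (hm.trans (hπ₁app z))).2
        ((hmemA z).1 hz)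
    · rintro ⟨m, hm0, rfl⟩
      obtain ⟨z, hz⟩ := L₁.toPoint_surjective (f₁ m)
      have hzA : z ∈ A :=
        (hmemA z).2 ((apply_eq_zero_iff_mul_mem_lattice hf₂ hrep hz.symm).1 hm0)
      exact ⟨⟨z, hzA⟩, hz⟩
  -- count
  have hcard : Nat.card (φ.ker.map f₁) = Nat.card φ.ker :=
    Nat.card_congr (φ.ker.equivMapOfInjective f₁ hf₁).toEquiv.symm
  rw [AddSubgroup.relIndex, ← hgker, AddSubgroup.index_ker, hgrange, hcard]

/-- **Silverman, *AEC*, Thm. VI.4.1(b) with the degree**, local form: under the hypotheses of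
the tree's `PeriodPair.exists_mul_of_curve_hom` (abstract groups `fᵢ : Mᵢ ↪ E_{Λᵢ}(ℂ)` with all
torsion of `E_{Λ₁}(ℂ)` in the image of `M₁`; `φ : M₁ →+ M₂` with finite kernel, agreeing off a
finite set with a rational map `(p₁/q₁, p₂/q₂)`), there is `α ≠ 0` with `αΛ₁ ⊆ Λ₂`,
**`[Λ₂ : αΛ₁] = #ker φ`** (the degree of the isogeny `z ↦ αz`, *AEC* III.4.10(c) / VI.4.1),
`φ = (z ↦ αz)` through the parametrisations, and the coordinate identity
`α · 2p₂'q₁'² = (δp₁'·q₁' − p₁'·δq₁')·q₂'` at every affine point for every rational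
representation of `φ` (`ψ^*ω' = αω`, *AEC* III.5). [cite: SilvermanAEC2009, Thm. VI.4.1(b) (PDF pp. 152–154), III.5 (PDF p. 75)] -/
theorem exists_mul_of_curve_hom_card_ker (L₁ L₂ : PeriodPair) {M₁ M₂ : Type*} [AddCommGroup M₁]
    [AddCommGroup M₂] [Infinite M₁] (φ : M₁ →+ M₂) (hker : (φ.ker : Set M₁).Finite)
    {W₁ W₂ : WeierstrassCurve ℂ} (hW₁ : W₁ = L₁.curve) (hW₂ : W₂ = L₂.curve)
    (f₁ : M₁ →+ W₁.toAffine.Point) (hf₁ : Function.Injective f₁)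
    (f₂ : M₂ →+ W₂.toAffine.Point) (hf₂ : Function.Injective f₂)
    (htors : ∀ n : ℕ, 0 < n → ∀ P : W₁.toAffine.Point, n • P = 0 → P ∈ f₁.range)
    (p₁ q₁ p₂ q₂ : MvPolynomial (Fin 2) ℂ)
    (halg : {m : M₁ | ¬ ∃ (x y : ℂ) (h : W₁.toAffine.Nonsingular x y),
        f₁ m = .some x y h ∧ MvPolynomial.eval ![x, y] q₁ ≠ 0 ∧ MvPolynomial.eval ![x, y] q₂ ≠ 0 ∧
        ∃ h' : W₂.toAffine.Nonsingular
            (MvPolynomial.eval ![x, y] p₁ / MvPolynomial.eval ![x, y] q₁)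
            (MvPolynomial.eval ![x, y] p₂ / MvPolynomial.eval ![x, y] q₂),
          f₂ (φ m) = .some _ _ h'}.Finite) :
    ∃ (α : ℂ) (hα : α ≠ 0), (∀ l ∈ L₁.lattice, α * l ∈ L₂.lattice) ∧
      (L₁.mulLeft α hα).lattice.toAddSubgroup.relIndex L₂.lattice.toAddSubgroup = Nat.card φ.ker ∧
      ∀ (p₁' q₁' p₂' q₂' : MvPolynomial (Fin 2) ℂ),
        {m : M₁ | ¬ ∃ (x y : ℂ) (h : W₁.toAffine.Nonsingular x y),
          f₁ m = .some x y h ∧ MvPolynomial.eval ![x, y] q₁' ≠ 0 ∧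
          MvPolynomial.eval ![x, y] q₂' ≠ 0 ∧
          ∃ h' : W₂.toAffine.Nonsingular
              (MvPolynomial.eval ![x, y] p₁' / MvPolynomial.eval ![x, y] q₁')
              (MvPolynomial.eval ![x, y] p₂' / MvPolynomial.eval ![x, y] q₂'),
            f₂ (φ m) = .some _ _ h'}.Finite →
        ∀ (m : M₁) (x y : ℂ) (h : W₁.toAffine.Nonsingular x y), f₁ m = .some x y h →
          α * MvPolynomial.eval ![x, y] (MvPolynomial.C 2 * p₂' * q₁' ^ 2) =
            MvPolynomial.eval ![x, y]
              ((W₁.invariantDerivation p₁' * q₁' - p₁' * W₁.invariantDerivation q₁') * q₂') := by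
  subst hW₁ hW₂
  obtain ⟨α, hα, hαΛ, hrep, hformula⟩ :=
    exists_mul_of_curve_hom_apply L₁ L₂ φ hker f₁ hf₁ f₂ hf₂ htors p₁ q₁ p₂ q₂ halg
  exact ⟨α, hα, hαΛ,
    (card_ker_eq_relIndex_of_apply_eq φ f₁ hf₁ f₂ hf₂ htors hα hαΛ hrep).symm, hformula⟩

end PeriodPair

end
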